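/-
Copyright: the b2b-balaban cell (near-miss cell 7), T⁴-continuum fan-out, lineage t4-ne7b-p1 (node U5c COUNT member).
Released under the licence of the surrounding project.
-/
import Summits.QuantumFields.BalabanUV.T4Continuum.Support.PlacementSkeleton

/-!
# Placement skeleton (part 2 of 2): exponent bookkeeping — the fibre factors multiply to `Λ^{partnerAges}` at the root

Summits-side support leaf of the T⁴-continuum cell (rung (B)+1 on a FINITE torus only; NOT infinite volume, NOT the
mass gap, NOT the Clay statement; NOT a proof of the spine estimate NE7b).  Lineage `t4-ne7b-p1`, node U5c, wall (GM).
[folklore] finite combinatorics and algebra over `ℝ`; nothing is quoted from print and nothing printed is asserted.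

WHAT THIS FILE DOES.  §4: `comb M st G p` — the re-rooted product of part 1 with the blocking-fibre factor stripped
(`M` for `N`); `weight_mul_pow`: if the one-merger bound carries the fibre factor of the PLACED piece,
`N q q' t · Λ^{st q} = M q q' t · Λ^{t+1}`, then `weight G p · Λ^{birthSum G} = Λ^{mergeSum G + st p} · comb M G p` for
every piece `p` born in `G` — INDEPENDENTLY of which pieces touch (re-rooting is exponent-neutral: one merger's worth
is `link_sum_mul_pow`); `weight_root_eq`: at the root piece, by the partner-ages identity of part 1,
`weight G root = Λ^{partnerAges st G} · comb M G root` EXACTLY (`Λ > 0`); `card_admSet_root_le`: the assembled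
multiplicity bound — admissible placements of a separated, step-consistent, ordered genealogy with its root piece at a
given cell number at most `Λ^{partnerAges st G} · comb M st G root`, i.e. the exponent of the binder `hlabM` on the
nose, times the displayed combinatorial factor.  §5: decided sanity instances, including a three-piece caterpillar whose
two pair sums give `weight = 5·(2·5) = 50` against `5² = 25` for one term per merger (the batch effect of part 1 (ii)).

WHAT THIS FILE DOES NOT DO.  It does not bound `comb` by `c^{#events}` (see part 1, LOCATED (ii)); it does not
instantiate `N`, `M`, `touch` (one-merger geometry leaf + reading (ID)); the size-ratio excess of `Q^d` over `Λ^{age}`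
under the typed flow stays where `Support/PartnerPlacement.lean` displays it.

HONEST DEPENDENCY (cell): continuum YM on T⁴ ⇐ BetaPertH ∧ nine spine estimates (0/9 proved); BetaPertH ⇐ (D1) ∧ (D4)
∧ CAP+tail.  This file changes none of it.
-/

open Finset
open Literature.MathematicalPhysics.QuantumFieldTheory.Balaban1983to89
open T4PersistenceDictionary T4PartnerMultiplicity

namespace Summit.QuantumFields.BalabanUV.T4Continuum.PlacementSkeleton

noncomputable section

variable {ε : Type*} [DecidableEq ε] {γ : Type*}

/-! ## §4 Exponent bookkeeping: the fibre factors multiply to `Λ^{partnerAges}` at the root -/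

/-- THE COMBINATORIAL FACTOR `comb M st G p`: the re-rooted product with the fibre factor `Λ^{t+1−s}` stripped from
`N` (same recursion as `weight`, with `M` for `N`). [folklore] -/
def comb (M : ε → ε → ℕ → ℝ) (st : ε → ℕ) : Gen ε → ε → ℝ
  | Gen.born _ _, _ => 1
  | Gen.renew G _ _, p => comb M st G p
  | Gen.merge X Y e, p =>
      if p ∈ births X then comb M st X p * ∑ q ∈ births Y, ∑ q' ∈ births X, M q q' (st e) * comb M st Y q
      else comb M st Y p * ∑ q' ∈ births X, ∑ q ∈ births Y, M q' q (st e) * comb M st X q'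

omit [DecidableEq ε] in
/-- One merger's worth of exponent bookkeeping: the placed side's fibre factors and its re-rooted product telescope.
[folklore] -/
theorem link_sum_mul_pow (st : ε → ℕ) {Λ : ℝ} {t B m : ℕ} (bU bV : Finset ε) (Nf Mf : ε → ε → ℝ)
    (w c' : ε → ℝ) (hw : ∀ q ∈ bV, w q * Λ ^ B = Λ ^ (m + st q) * c' q)
    (hNM : ∀ q ∈ bV, ∀ q' ∈ bU, Nf q q' * Λ ^ st q = Mf q q' * Λ ^ (t + 1)) :
    (∑ q ∈ bV, ∑ q' ∈ bU, Nf q q' * w q) * Λ ^ B = Λ ^ (m + (t + 1)) * ∑ q ∈ bV, ∑ q' ∈ bU, Mf q q' * c' q := by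
  rw [sum_mul, mul_sum]
  refine sum_congr rfl fun q hq => ?_
  rw [sum_mul, mul_sum]
  refine sum_congr rfl fun q' hq' => ?_
  calc Nf q q' * w q * Λ ^ B = Nf q q' * (w q * Λ ^ B) := by ring
    _ = Nf q q' * (Λ ^ (m + st q) * c' q) := by rw [hw q hq]
    _ = (Nf q q' * Λ ^ st q) * Λ ^ m * c' q := by rw [pow_add]; ring
    _ = (Mf q q' * Λ ^ (t + 1)) * Λ ^ m * c' q := by rw [hNM q hq q' hq']
    _ = Λ ^ (m + (t + 1)) * (Mf q q' * c' q) := by rw [pow_add]; ring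

/-- **EXPONENT BOOKKEEPING.**  If the one-merger bound carries the fibre factor of the placed piece,
`N q q' t · Λ^{st q} = M q q' t · Λ^{t+1}`, then `weight G p · Λ^{birthSum G} = Λ^{mergeSum G + st p} · comb M G p`
for every piece `p` born in `G` — independently of which pieces touch. [folklore] -/
theorem weight_mul_pow (N : ε → ε → ℕ → ℕ) (M : ε → ε → ℕ → ℝ) (st : ε → ℕ) {Λ : ℝ}
    (hNM : ∀ q q' t, (N q q' t : ℝ) * Λ ^ st q = M q q' t * Λ ^ (t + 1)) :
    ∀ (G : Gen ε) (p : ε), p ∈ births G →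
      (weight N st G p : ℝ) * Λ ^ birthSum st G = Λ ^ (mergeSum st G + st p) * comb M st G p
  | Gen.born b j, p, hp => by
      have hpb : p = b := by simpa using hp
      subst hpb
      simp [weight, birthSum, mergeSum, comb]
  | Gen.renew G e h, p, hp => weight_mul_pow N M st hNM G p hp
  | Gen.merge X Y e, p, hp => by
      have ihX := fun q hq => weight_mul_pow N M st hNM X q hq
      have ihY := fun q hq => weight_mul_pow N M st hNM Y q hq
      by_cases hpX : p ∈ births X
      · rw [weight, comb, if_pos hpX, if_pos hpX, birthSum, mergeSum]
        push_cast
        have hlink := link_sum_mul_pow st (births X) (births Y) (fun q q' => (N q q' (st e) : ℝ))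
          (fun q q' => M q q' (st e)) (fun q => (weight N st Y q : ℝ)) (comb M st Y) ihY
          (fun q _ q' _ => hNM q q' (st e))
        calc (weight N st X p : ℝ) * (∑ q ∈ births Y, ∑ q' ∈ births X,
                (N q q' (st e) : ℝ) * (weight N st Y q : ℝ)) * Λ ^ (birthSum st X + birthSum st Y)
            = ((weight N st X p : ℝ) * Λ ^ birthSum st X) * ((∑ q ∈ births Y, ∑ q' ∈ births X,
                (N q q' (st e) : ℝ) * (weight N st Y q : ℝ)) * Λ ^ birthSum st Y) := by rw [pow_add]; ring
          _ = (Λ ^ (mergeSum st X + st p) * comb M st X p) * (Λ ^ (mergeSum st Y + (st e + 1)) *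
                ∑ q ∈ births Y, ∑ q' ∈ births X, M q q' (st e) * comb M st Y q) := by rw [ihX p hpX, hlink]
          _ = Λ ^ (mergeSum st X + mergeSum st Y + (st e + 1) + st p) *
                (comb M st X p * ∑ q ∈ births Y, ∑ q' ∈ births X, M q q' (st e) * comb M st Y q) := by
              rw [pow_add, pow_add, pow_add, pow_add]; ring
      · have hpY : p ∈ births Y := by
          rcases mem_union.1 hp with h | h
          · exact absurd h hpX
          · exact h
        rw [weight, comb, if_neg hpX, if_neg hpX, birthSum, mergeSum]
        push_cast
        have hlink := link_sum_mul_pow st (births Y) (births X) (fun q' q => (N q' q (st e) : ℝ))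
          (fun q' q => M q' q (st e)) (fun q' => (weight N st X q' : ℝ)) (comb M st X) ihX
          (fun q' _ q _ => hNM q' q (st e))
        calc (weight N st Y p : ℝ) * (∑ q' ∈ births X, ∑ q ∈ births Y,
                (N q' q (st e) : ℝ) * (weight N st X q' : ℝ)) * Λ ^ (birthSum st X + birthSum st Y)
            = ((weight N st Y p : ℝ) * Λ ^ birthSum st Y) * ((∑ q' ∈ births X, ∑ q ∈ births Y,
                (N q' q (st e) : ℝ) * (weight N st X q' : ℝ)) * Λ ^ birthSum st X) := by rw [pow_add]; ring
          _ = (Λ ^ (mergeSum st Y + st p) * comb M st Y p) * (Λ ^ (mergeSum st X + (st e + 1)) *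
                ∑ q' ∈ births X, ∑ q ∈ births Y, M q' q (st e) * comb M st X q') := by rw [ihY p hpY, hlink]
          _ = Λ ^ (mergeSum st X + mergeSum st Y + (st e + 1) + st p) *
                (comb M st Y p * ∑ q' ∈ births X, ∑ q ∈ births Y, M q' q (st e) * comb M st X q') := by
              rw [pow_add, pow_add, pow_add, pow_add]; ring

/-- **AT THE ROOT THE EXPONENT IS `partnerAges` ON THE NOSE**: `weight G root = Λ^{partnerAges st G} · comb M G root`
(`Λ > 0`, steps and order as in `partnerAges_add_birthSum`). [folklore] -/
theorem weight_root_eq (N : ε → ε → ℕ → ℕ) (M : ε → ε → ℕ → ℝ) (st : ε → ℕ) {Λ : ℝ} (hΛ : 0 < Λ)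
    (hNM : ∀ q q' t, (N q q' t : ℝ) * Λ ^ st q = M q q' t * Λ ^ (t + 1))
    (G : Gen ε) (hS : StepsOK st G) (hO : Ordered st G) :
    (weight N st G G.root : ℝ) = Λ ^ partnerAges st G * comb M st G G.root := by
  have h1 := weight_mul_pow N M st hNM G G.root (root_mem_births G)
  have h2 := partnerAges_add_birthSum st hS hO
  have h3 := rootStep_eq_st_root st hS
  have hpow : Λ ^ (mergeSum st G + st G.root) = Λ ^ partnerAges st G * Λ ^ birthSum st G := by
    rw [← pow_add, ← h3, ← h2]
  have hne : Λ ^ birthSum st G ≠ 0 := pow_ne_zero _ hΛ.ne'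
  rw [hpow] at h1
  apply mul_right_cancel₀ hne
  calc (weight N st G G.root : ℝ) * Λ ^ birthSum st G
      = Λ ^ partnerAges st G * Λ ^ birthSum st G * comb M st G G.root := h1
    _ = Λ ^ partnerAges st G * comb M st G G.root * Λ ^ birthSum st G := by ring

section Root

variable [Fintype ε] [Fintype γ] [DecidableEq γ]

open scoped Classical

/-- **THE ASSEMBLED MULTIPLICITY BOUND** (what the labelling binder `hlabM` asks of geometry, in abstract form): for a
separated, step-consistent, ordered genealogy rooted at its root piece placed at `c`, the admissible placements number
at most `Λ^{partnerAges st G} · comb M st G root`, given the one-merger bounds `hN1`/`hN2` with fibre factor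
`N·Λ^{s} = M·Λ^{t+1}`. [folklore] -/
theorem card_admSet_root_le (touch : ε → ε → ℕ → γ → γ → Prop) (st : ε → ℕ) (N : ε → ε → ℕ → ℕ)
    (M : ε → ε → ℕ → ℝ) {Λ : ℝ} (hΛ : 0 < Λ)
    (hN1 : ∀ q q' t y, (univ.filter fun x : γ => touch q q' t x y).card ≤ N q q' t)
    (hN2 : ∀ q q' t x, (univ.filter fun y : γ => touch q q' t x y).card ≤ N q' q t)
    (hNM : ∀ q q' t, (N q q' t : ℝ) * Λ ^ st q = M q q' t * Λ ^ (t + 1))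
    (G : Gen ε) (hsep : Separated G) (hS : StepsOK st G) (hO : Ordered st G) (c c₀ : γ) :
    ((admSet touch st G G.root c c₀).card : ℝ) ≤ Λ ^ partnerAges st G * comb M st G G.root := by
  rw [← weight_root_eq N M st hΛ hNM G hS hO]
  exact_mod_cast card_admSet_le_weight touch st N hN1 hN2 G hsep G.root (root_mem_births G) c c₀

end Root

/-! ## §5 Sanity (decided instances) -/

namespace Sanity

/-- steps of the three events `0 ↦ 0`, `1 ↦ 1`, `2 ↦ 2` [folklore] -/
def st₀ : Fin 3 → ℕ := fun i => i

/-- two pieces born at steps `0` and `1`, merged by event `2` at step `2` [folklore] -/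
def G₁ : Gen (Fin 3) := Gen.merge (Gen.born 0 0) (Gen.born 1 1) 2

/-- the identity `partnerAges + Σ births = Σ (mergers + 1) + rootStep` on `G₁`: `2 + 1 = 3 + 0` [folklore] -/
theorem identity_G₁ : partnerAges st₀ G₁ + birthSum st₀ G₁ = mergeSum st₀ G₁ + G₁.rootStep := by decide

/-- with the constant one-merger bound `N = 5` the re-rooted product of `G₁` at its root is `5`, at the younger
piece also `5` [folklore] -/
theorem weight_G₁ : weight (fun _ _ _ => 5) st₀ G₁ 0 = 5 ∧ weight (fun _ _ _ => 5) st₀ G₁ 1 = 5 := by decide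

/-- a three-piece caterpillar merged twice at the same step: the pair sums give `1·(5·1) · ((5 + 5)·…)`-type growth —
`weight = 5 · (2·5) = 50` at the root, against `5² = 25` for a product of one term per merger [folklore] -/
theorem weight_caterpillar :
    weight (fun _ _ _ => 5) (fun i : Fin 5 => if i = 3 ∨ i = 4 then 2 else (i : ℕ))
      (Gen.merge (Gen.merge (Gen.born 0 0) (Gen.born 1 1) 3) (Gen.born 2 2) 4) 0 = 50 := by decide

end Sanity

end

end Summit.QuantumFields.BalabanUV.T4Continuum.PlacementSkeleton
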